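import Summits.HodgeConjecture.HodgeConjecture.Theorems.TropicalWeilObstructionTropicalHodgeBoundCertDataA

/-!
# Crux `TropicalHodgeBound` (stmt-HodgeConjecture-18480), stub 4 — part C4.2: kernel run of the
# certificate, chunks 7–13

Route `TropicalWeilObstruction` of `HodgeConjecture`, registered line `birth`, stub
`stub_rationalHodgeCoordinates`. Each theorem states that one chunk of the propagation certificate
(`…CertData*`) passes the checker `Chk.checkChunk` of `…ChkCore` (incoming boundary facts, packed steps,
outgoing boundary facts, final unknowns); proved by `decide +kernel` (pure integer/list computation,
≈ 10⁶–10⁷ kernel reductions per chunk, hence the raised `maxHeartbeats`/`maxRecDepth`). Soundness of the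
checker (`…CheckerSound`, `…CheckerEquations`) turns these into linear relations among the integer
coordinates of a tropical cycle class (`…Certificate`).

References: [Zharkov2020TropicalWeil] I. Zharkov, arXiv:2002.02347, §2; [MikhalkinZharkov2014Eigenwave]
G. Mikhalkin, I. Zharkov, LN UMI 15 (2014), Thm. 5.4.
-/

set_option linter.dupNamespace false

namespace Summit.HodgeConjecture.HodgeConjecture.Theorems.TropicalHodgeBound

namespace Chk

set_option maxRecDepth 100000 in
set_option maxHeartbeats 400000000 in
/-- Chunk `7` of the certificate passes the checker. [cite: Zharkov2020TropicalWeil, §2] -/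
theorem chunk7_ok : checkChunk [] ch7 [] (ch7.map stepTarget) = true := by
  decide +kernel

set_option maxRecDepth 100000 in
set_option maxHeartbeats 400000000 in
/-- Chunk `8` of the certificate passes the checker. [cite: Zharkov2020TropicalWeil, §2] -/
theorem chunk8_ok : checkChunk [] ch8 [] (ch8.map stepTarget) = true := by
  decide +kernel

set_option maxRecDepth 100000 in
set_option maxHeartbeats 400000000 in
/-- Chunk `9` of the certificate passes the checker. [cite: Zharkov2020TropicalWeil, §2] -/
theorem chunk9_ok : checkChunk [] ch9 [] (ch9.map stepTarget) = true := by
  decide +kernel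

set_option maxRecDepth 100000 in
set_option maxHeartbeats 400000000 in
/-- Chunk `10` of the certificate passes the checker. [cite: Zharkov2020TropicalWeil, §2] -/
theorem chunk10_ok : checkChunk [] ch10 [] (ch10.map stepTarget) = true := by
  decide +kernel

set_option maxRecDepth 100000 in
set_option maxHeartbeats 400000000 in
/-- Chunk `11` of the certificate passes the checker. [cite: Zharkov2020TropicalWeil, §2] -/
theorem chunk11_ok : checkChunk [] ch11 [] (ch11.map stepTarget) = true := by
  decide +kernel

set_option maxRecDepth 100000 in
set_option maxHeartbeats 400000000 in
/-- Chunk `12` of the certificate passes the checker. [cite: Zharkov2020TropicalWeil, §2] -/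
theorem chunk12_ok : checkChunk [] ch12 [] (ch12.map stepTarget) = true := by
  decide +kernel

set_option maxRecDepth 100000 in
set_option maxHeartbeats 400000000 in
/-- Chunk `13` of the certificate passes the checker. [cite: Zharkov2020TropicalWeil, §2] -/
theorem chunk13_ok : checkChunk [] ch13 [] (ch13.map stepTarget) = true := by
  decide +kernel

end Chk

end Summit.HodgeConjecture.HodgeConjecture.Theorems.TropicalHodgeBound
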